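/-
Origin: expansion seat `planner-pub-hodgecm-mc-axioms-1-g14-0`, handover #W31 2026-08-20T15:53:55Z md5 7c01f53168bc (PKG 9f356c16ff43 → 7c01f53168bc; 165 l.; MECHANICAL (iib-R) rewrite v3.1 of the PKG file as it stands (14 token edits; rules R1x1+R2x1+RX[h₂]x12)) (`HOME/mc/pub-hodgecm-mc-axioms-1-g14/revendor/kit-r55/stage55/HodgeCM/Model/HsmallOfCommonReflex.lean`, md5 7c01f53168bc, 165 lines);
landed by the gen-22 packager (p-g22) in gate run 55 REPLACES the earlier landed copy of `HodgeCM/Model/HsmallOfCommonReflex.lean` (seat copy carried the packager Origin header of an earlier run (stripped)).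
-/
/-
Copyright (c) 2026 the pub-hodgecm formalisation cell (harness21).  New file, not vendored.
Origin: HOME/mc/pub-hodgecm-mc-axioms-1-g12/lean/jliu/HodgeCM/Model/HsmallOfCommonReflex.lean — session
planner-pub-hodgecm-mc-axioms-1-g12-0 (unit pub-hodgecm-mc-axioms-1-g12, CONSTRUCTION PROVER gen 12 of lineage mc-axioms-1,
node N-i1 (L-lvl)), 2026-08-20.  Intended final place: `HodgeCM/Model/HsmallOfCommonReflex.lean` (NEW additive MODEL leaf;
imports `HodgeCM.Model.UisoOfCommonReflex` (J) and `HodgeCM.PerL34.ThetaSubOfLiu` (`CMTypeOps.inflate`, `ThetaModel`)).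
(J-Liu-iso) JUNCTION, E-SHAPE: node E's binder `hsmall` of `Model.hLiu_of_smallLevel` (BINDER-OWNERS row 9, BINDER-TRIAGE §58:
P-PENDING → CITE [Liu21] + junction) FROM a per-level common-reflex factorisation of the theta classes — route R-down of the
axioms-1-g10 memo `HOME/mc/pub-hodgecm-mc-axioms-1-g10/notes/J-Liu-iso-memo.md` §3 (`M := c.K`, `k := id`, `σ' := c.σ`).
-/
import Summits.HodgeConjecture.HodgeCM.Model.UisoOfCommonReflex
import Summits.HodgeConjecture.HodgeCM.PerL34.ThetaSubOfLiu_2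

set_option autoImplicit false

/-!
# E's `hsmall` from a common-reflex factorisation of the theta classes

KERNEL over the rows of `picardCMUniverse` and Riemann's fullness `hR`.  For ANY theta model `R` on the end-state universe
`U = picardCMUniverse hHD hI h₁ h₃`:

* `HodgeCM.Model.CommonReflexInput K Ψ σ` — the CONTENT to be supplied per corner `(K, Ψ_i, σ)` and level: a CM pair
  `(M', Φ')` with `k₁ : M' → K` inflating `Φ'` to `Ψ` (membership clause), a number field `M` with `k₂ : M' → M` and the
  `k₂`-inflated type `Φ_A`, an abelian variety `(A, ι_A, θ_A)` realising `(M; Φ_A)` (for [Liu21]: `A = A_μ`, Thm 4.15 /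
  Def 4.16), and `τ : M → ℂ` with `τ ∘ k₂ = σ ∘ k₁`; `D.classes X` = the classes `(f^*)_ℂ α` on a scheme `X`, `f : X → A`,
  `α` a `τ`-eigenvector of `ℂ ⊗ H¹(A; ℚ)`.
* `HodgeCM.Model.CommonReflexInput.surfaceClasses` — `D.classes P_Γ` on THE realised surface, typed in `U.CohC (U.pms L ι₁ V Γ) 1`;
  `HodgeCM.Model.span_classes_le_Uiso` — (J) for such a datum: `span (D.surfaceClasses V Γ) ≤ U.Uiso Γ K Ψ σ` (`σ ∈ Ψ`, `hR`).
* `HodgeCM.Model.hsmall_of_commonReflexInput` — E's binder `hsmall` VERBATIM IN SHAPE (for `R := thetaModelOf …` it is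
  literally the binder type of `Model.hLiu_of_smallLevel`): if for every good context with `[K:ℚ] = 6` and every `i` there is
  a level `Γ₀` below which `R.Theta V c i Γ ⊆ span (D.classes P_Γ)` for SOME `D : CommonReflexInput c.K (c.Ψ i) c.σ`, then
  `∃ Γ₀ ∀ Γ ≤ Γ₀ ∃ (M k σ'), σ' ∘ k = c.σ ∧ R.Theta V c i Γ ⊆ U.Uiso Γ M (inflate k (c.Ψ i)) σ'` — with the witnesses
  `M := c.K`, `k := id`, `σ' := c.σ` (`CMTypeOps.inflate_id`); `c.σ ∈ c.Ψ i` is `GoodCtx.mem`.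

What this file does NOT contain (content lanes (P-i)/(J-Liu-Θ)/(J-Liu-K), RUN 39+): the datum `D` for Liu's `A_μ` and the
inclusion `Theta V c i Γ ⊆ span (D.classes P_Γ)` ([Liu21] = arXiv:2102.11518, Thm. 4.18 and its proof's map (4.3) «by pulling
back α», typed AS PRINTED in `HodgeCM/Literature/AlbaneseUnitaryShimuraCM.lean`).  Nothing of PerL / [QW8] / the 2001
programme is used or asserted.
-/

noncomputable section

open scoped TensorProduct
open NumberField CategoryTheory Module

namespace HodgeCM

namespace Model

open Literature.AlgebraicGeometry.Motives (CMType AbelianVariety bettiCohomology SchemeOver)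
open Literature.AlgebraicGeometry.HodgeTheory
open Literature.AlgebraicGeometry.HodgeTheory.BettiUniverse (pull cmAction IsInducedOnIntegers)
open Literature.AlgebraicGeometry.ComplexMultiplication (IsCMTypeRealisation)
open Literature.NumberTheory.Automorphic.PicardCM
open HodgeCM.CM.CommonReflex (complexify)
open HodgeCM.CMTypeOps (inflate inflate_id)
open HodgeCM.Universe (ThetaModel)

/-- **The common-reflex content for a corner `(K, Ψ, σ)`**: a CM pair `(M', Φ')` of which `Ψ` is the inflation along
`k₁ : M' → K`, a number field `M` with `k₂ : M' → M` and the inflated type `Φ_A`, an abelian variety `A/ℂ` with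
`𝓞_M`-multiplication realising `(M; Φ_A)` on `H¹`, and an embedding `τ : M → ℂ` over `σ` (`τ ∘ k₂ = σ ∘ k₁`).  DATA (a
`Type`), asserted by no one: the junction theorems below take it as a hypothesis. [folklore] -/
structure CommonReflexInput (K : CMField) (Ψ : CMType K) (σ : K →+* ℂ) : Type 1 where
  /-- the base field `M'` of the common reflex pair -/
  M' : Type
  [instFieldBase : Field M']
  [instNumberFieldBase : NumberField M']
  [instIsCMFieldBase : IsCMField M']
  /-- its CM type `Φ'` -/
  Φ' : CMType M'
  /-- `k₁ : M' → K` -/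
  k₁ : M' →+* K
  /-- `Ψ = Φ'^K`: `τ ∈ Ψ ↔ τ ∘ k₁ ∈ Φ'` -/
  mem_iff : ∀ τ : K →+* ℂ, τ ∈ Ψ.1 ↔ τ.comp k₁ ∈ Φ'.1
  /-- the CM field `M` of the auxiliary abelian variety -/
  M : Type
  [instField : Field M]
  [instNumberField : NumberField M]
  /-- `k₂ : M' → M` -/
  k₂ : M' →+* M
  /-- the inflated type `Φ_A = Φ'^M` -/
  ΦA : CMType M
  /-- `τ ∈ Φ_A ↔ τ ∘ k₂ ∈ Φ'` -/
  memA_iff : ∀ τ : M →+* ℂ, τ ∈ ΦA.1 ↔ τ.comp k₂ ∈ Φ'.1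
  /-- the auxiliary abelian variety `A/ℂ` -/
  A : AbelianVariety ℂ
  /-- its `𝓞_M`-multiplication -/
  ιA : 𝓞 M →+* End A
  /-- the action of `M` on `H¹(A(ℂ); ℂ)` -/
  θA : M →+* Module.End ℂ (complexBetti A.X 1)
  /-- `(A, ι_A, θ_A)` realises `(M; Φ_A)` on `H¹` -/
  isRealisation : IsCMTypeRealisation ΦA A ιA θA
  /-- the embedding `τ : M → ℂ` -/
  τ : M →+* ℂ
  /-- `τ` lies over `σ` on `M'` -/
  comp_eq : τ.comp k₂ = σ.comp k₁

attribute [instance] CommonReflexInput.instFieldBase CommonReflexInput.instNumberFieldBase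
  CommonReflexInput.instIsCMFieldBase CommonReflexInput.instField CommonReflexInput.instNumberField

namespace CommonReflexInput

variable {K : CMField} {Ψ : CMType K} {σ : K →+* ℂ}

/-- The classes `(f^*)_ℂ α ∈ ℂ ⊗ H¹(X; ℚ)` on a scheme `X/ℂ`: `f : X → A` a morphism, `α` a `τ`-eigenvector of the
complexified rational CM action on `ℂ ⊗ H¹(A; ℚ)`. [folklore] -/
def classes (D : CommonReflexInput K Ψ σ) (X : SchemeOver ℂ) : Set (ℂ ⊗[ℚ] bettiCohomology X 1) :=
  {x | ∃ (f : X ⟶ D.A.X) (α : ℂ ⊗[ℚ] bettiCohomology D.A.X 1),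
    α ∈ eigenline (complexify (cmAction D.θA D.isRealisation.isInducedOnIntegers)) D.τ ∧
      x = (pull f 1).baseChange ℂ α}

end CommonReflexInput

variable (hHD : exists_isReal_hodgeModel) (hI : hodgePQ_independent_of_hodgeModel)
  (h₁ : BallQuotientUniformised)  (h₃ : CMAbelianVarietyRealised)

/-- `D.classes` on THE realised surface `P_Γ` of the end-state universe (the scheme under `U.pms L ι₁ V Γ`), as a set of
classes of `U.CohC (U.pms L ι₁ V Γ) 1 = ℂ ⊗ H¹(P_Γ; ℚ)` (the same set; `U.Coh (U.pms …) 1` unfolds to `H¹` of that scheme,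
`rfl`). [folklore] -/
def CommonReflexInput.surfaceClasses {K : CMField} {Ψ : CMType K} {σ : K →+* ℂ} (D : CommonReflexInput K Ψ σ)
    {L : CMField} {ι₁ : L →+* ℂ} (V : HermSpace3 L ι₁) (Γ : Level V) :
    Set ((picardCMUniverse hHD hI h₁ h₃).CohC ((picardCMUniverse hHD hI h₁ h₃).pms L ι₁ V Γ) 1) :=
  D.classes (pmsRealisation (ballQuotientUniformisedDatum_of h₁) (pmsCode L ι₁ V Γ)).X

/-- **(J) for a common-reflex datum**: on the end-state universe, the span of `D.classes P_Γ` (classes pulled back to THE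
realised surface at level `Γ`) lies in `Uiso Γ K Ψ σ`, for `σ ∈ Ψ`, granted Riemann's fullness `hR`. [folklore] -/
theorem span_classes_le_Uiso (hR : DeligneMilne1982_Thm_6_20_full)
    {L : CMField} {ι₁ : L →+* ℂ} (V : HermSpace3 L ι₁) (Γ : Level V)
    {K : CMField} {Ψ : CMType K} {σ : K →+* ℂ} (hσ : σ ∈ Ψ.1) (D : CommonReflexInput K Ψ σ) :
    Submodule.span ℂ (D.surfaceClasses hHD hI h₁ h₃ V Γ) ≤ (picardCMUniverse hHD hI h₁ h₃).Uiso Γ K Ψ σ :=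
  span_pull_eigenline_le_Uiso hHD hI h₃ h₁ V Γ K Ψ hσ D.k₁ D.mem_iff D.k₂ D.memA_iff D.isRealisation
    D.isRealisation.isInducedOnIntegers hR D.comp_eq

/-- **E's binder `hsmall` from a per-level common-reflex factorisation of the theta classes.**  For any theta model `R`
on `picardCMUniverse hHD hI h₁ h₃`: if in every good seesaw context with `[K:ℚ] = 6`, for every `i`, there is a level
`Γ₀` such that for all `Γ ≤ Γ₀` the theta classes `R.Theta V c i Γ` lie in the span of `D.classes P_Γ` for some common-reflex
datum `D` of the corner `(c.K, c.Ψ i, c.σ)`, then the `hsmall` hypothesis of `Model.hLiu_of_smallLevel` holds for `R`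
(witnesses `M := c.K`, `k := id`, `σ' := c.σ`). [folklore] -/
theorem hsmall_of_commonReflexInput (hR : DeligneMilne1982_Thm_6_20_full)
    (R : (picardCMUniverse hHD hI h₁ h₃).ThetaModel)
    (hΘ : ∀ {L : CMField} {ι₁ : L →+* ℂ} (V : HermSpace3 L ι₁) (c : SeesawCtx L), R.GoodCtx ι₁ c →
      Module.finrank ℚ c.K = 6 → ∀ i : Fin 4, ∃ Γ₀ : Level V, ∀ Γ ≤ Γ₀,
        ∃ D : CommonReflexInput c.K (c.Ψ i) c.σ,
          R.Theta V c i Γ ⊆ Submodule.span ℂ (D.surfaceClasses hHD hI h₁ h₃ V Γ)) :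
    ∀ {L : CMField} {ι₁ : L →+* ℂ} (V : HermSpace3 L ι₁) (c : SeesawCtx L), R.GoodCtx ι₁ c →
      Module.finrank ℚ c.K = 6 → ∀ i : Fin 4, ∃ Γ₀ : Level V, ∀ Γ ≤ Γ₀,
        ∃ (M : CMField) (k : c.K →+* M) (σ' : M →+* ℂ), σ'.comp k = c.σ ∧
          R.Theta V c i Γ ⊆ (picardCMUniverse hHD hI h₁ h₃).Uiso Γ M (inflate k (c.Ψ i)) σ' := by
  intro L ι₁ V c hgood h6 i
  obtain ⟨Γ₀, hΓ₀⟩ := hΘ V c hgood h6 i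
  refine ⟨Γ₀, fun Γ hΓ ↦ ?_⟩
  obtain ⟨D, hsub⟩ := hΓ₀ Γ hΓ
  refine ⟨c.K, RingHom.id _, c.σ, RingHom.comp_id _, ?_⟩
  rw [inflate_id]
  exact fun x hx ↦ span_classes_le_Uiso hHD hI h₁ h₃ hR V Γ (hgood.mem i) D (hsub hx)

end Model

end HodgeCM

end
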